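import Mathlib
import Summits.NavierStokesRegularity.NavierStokesRegularity.Theorems.FilamentSkeletonRssSkeletonJ1RFrameDefs

/-!
# Route `FilamentSkeletonRss` · crux `SkeletonJ1R` (stmt-NavierStokesRegularity-23610) · registered line `streamline_kantorovich_R`
# — brick for stubs L / K: the DERIVATIVE OF THE SLICED MODEL ALONG THE REFERENCE is pinned by the slice formula

Lead `ns-fsr-lead-23610` (g0), `--supports stmt-NavierStokesRegularity-23610 --as helper`.

For a datum-sliced model (`SlicedModel Γ ρ λ t x M`, FrameDefs §5: `M (x_j τ + z) = (7/4)τ·x_j′ τ − λ z` for `z ⊥ t_j`, `‖z‖ ≤ ρ√Γ/8`) with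
`0 < ρ√Γ`, the first derivative of `M` at every reference point is DETERMINED although `M` is free off the slices:
* `SlicedModel.fderiv_apply_slice` — `DM(x_j τ) z = −λ z` for every `z ⊥ t_j` (differentiate `s ↦ M(x_j τ + s z)`);
* `SlicedModel.fderiv_apply_tangent` — `DM(x_j τ)(x_j′ τ) = (7/4)·x_j′ τ + ((7/4)τ)·x_j″ τ` (differentiate `τ ↦ M(x_j τ) = (7/4)τ·x_j′ τ`; needs
  `x_j ∈ C²`).
Since `t_j` and `x_j′ τ` are not orthogonal for a near-straight reference, `{z ⊥ t_j} ⊕ ℝ x_j′ τ = ℝ³`, so these two facts pin `DM(x_j τ)`; they are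
what the linearised switched defect (`…SkeletonJ1RSwDefectVariation`) needs in the collar and the model region (stub L), and what stub K's Lipschitz
bookkeeping starts from.

HONEST FRAMING.  Calculus for the ∃-side of a HYPOTHETICAL filament-type rotating-self-similar blow-up skeleton (MODEL rung, negative side); nothing
here is a claim about Navier–Stokes regularity or blow-up; stubs L, K and the crux stay OPEN.
-/

set_option linter.dupNamespace false -- `NavierStokesRegularity.NavierStokesRegularity` path/namespace repetition is the tree convention

noncomputable section

namespace Summit.NavierStokesRegularity.NavierStokesRegularity.Theorems.SkeletonJ1RFrame

open Set Function Filter Real Topology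
open scoped InnerProductSpace

variable {N : ℕ} {Γ ρ lam : ℝ} {t : Fin N → EuclideanSpace ℝ (Fin 3)} {x : Fin N → ℝ → EuclideanSpace ℝ (Fin 3)}
  {M : EuclideanSpace ℝ (Fin 3) → EuclideanSpace ℝ (Fin 3)}

/-- **Slice derivative.**  For a sliced model with `0 < ρ√Γ`: `DM(x_j τ) z = −λ z` for every `z ⊥ t_j`. [folklore] -/
theorem SlicedModel.fderiv_apply_slice (hM : SlicedModel Γ ρ lam t x M) (hρΓ : 0 < ρ * Real.sqrt Γ) (j : Fin N) (τ : ℝ)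
    (z : EuclideanSpace ℝ (Fin 3)) (hz : inner ℝ z (t j) = 0) : fderiv ℝ M (x j τ) z = -(lam • z) := by
  obtain ⟨hMC, -, hslice⟩ := hM
  set c : EuclideanSpace ℝ (Fin 3) := ((7/4:ℝ) * τ) • deriv (x j) τ with hc
  -- the line s ↦ x_j τ + s z
  have hline : HasDerivAt (fun s : ℝ => M (x j τ + s • z)) (fderiv ℝ M (x j τ) z) 0 := by
    have hp : HasDerivAt (fun s : ℝ => x j τ + s • z) z 0 := by
      simpa using ((hasDerivAt_id' (x := (0:ℝ))).smul_const z).const_add (x j τ)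
    have hd : DifferentiableAt ℝ M (x j τ) := (hMC.differentiable (by norm_num)).differentiableAt
    exact hd.hasFDerivAt.comp_hasDerivAt_of_eq (0:ℝ) hp (by simp)
  -- on a neighbourhood of 0 the slice formula holds, written as an affine function of s
  have hformula : (fun s : ℝ => c + s • (-(lam • z))) =ᶠ[𝓝 0] fun s => M (x j τ + s • z) := by
    have key : ∀ s : ℝ, |s| * ‖z‖ ≤ ρ * Real.sqrt Γ / 8 → c + s • (-(lam • z)) = M (x j τ + s • z) := by
      intro s hs
      have h := hslice j τ (s • z) (by rw [inner_smul_left, hz, mul_zero]) (by rw [norm_smul, Real.norm_eq_abs]; exact hs)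
      rw [h, hc, smul_comm lam s z, smul_neg, sub_eq_add_neg]
    by_cases hz0 : z = 0
    · exact Eventually.of_forall fun s => key s (by rw [hz0, norm_zero, mul_zero]; positivity)
    · have hzn : 0 < ‖z‖ := norm_pos_iff.2 hz0
      have hr : 0 < ρ * Real.sqrt Γ / 8 / ‖z‖ := by positivity
      filter_upwards [Metric.ball_mem_nhds (0:ℝ) hr] with s hs
      rw [Metric.mem_ball, dist_zero_right, Real.norm_eq_abs] at hs
      exact key s (by have := (lt_div_iff₀ hzn).1 hs; linarith)
  have hline' : HasDerivAt (fun s : ℝ => c + s • (-(lam • z))) (-(lam • z)) 0 :=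
    (((hasDerivAt_id' (0:ℝ)).smul_const (-(lam • z))).const_add c).congr_deriv (one_smul _ _)
  exact (hline.congr_of_eventuallyEq hformula).unique hline'

/-- **Tangential derivative.**  For a sliced model with `0 ≤ ρ√Γ` and a `C²` reference curve `x_j`:
`DM(x_j τ)(x_j′ τ) = (7/4)·x_j′ τ + ((7/4)τ)·x_j″ τ`. [folklore] -/
theorem SlicedModel.fderiv_apply_tangent (hM : SlicedModel Γ ρ lam t x M) (hρΓ : 0 ≤ ρ * Real.sqrt Γ) (j : Fin N)
    (hx : ContDiff ℝ 2 (x j)) (τ : ℝ) :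
    fderiv ℝ M (x j τ) (deriv (x j) τ) = (7/4:ℝ) • deriv (x j) τ + ((7/4:ℝ) * τ) • iteratedDeriv 2 (x j) τ := by
  obtain ⟨hMC, -, hslice⟩ := hM
  have hxd : Differentiable ℝ (x j) := hx.differentiable (by norm_num)
  have hx'd : Differentiable ℝ (deriv (x j)) := by
    have h := (contDiff_succ_iff_deriv.1 (show ContDiff ℝ (1 + 1) (x j) from hx)).2.2
    exact h.differentiable (by norm_num)
  -- along the curve: M (x_j s) = (7/4) s • x_j′ s
  have hcurve : ∀ s, M (x j s) = ((7/4:ℝ) * s) • deriv (x j) s := fun s => by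
    have h := hslice j s 0 (inner_zero_left _) (by rw [norm_zero]; positivity)
    rwa [add_zero, smul_zero, sub_zero] at h
  have h1 : HasDerivAt (fun s => M (x j s)) (fderiv ℝ M (x j τ) (deriv (x j) τ)) τ :=
    ((hMC.differentiable (by norm_num)).differentiableAt.hasFDerivAt).comp_hasDerivAt τ (hxd τ).hasDerivAt
  have h2 : HasDerivAt (fun s => ((7/4:ℝ) * s) • deriv (x j) s) ((7/4:ℝ) • deriv (x j) τ + ((7/4:ℝ) * τ) • deriv (deriv (x j)) τ) τ := by
    have ha : HasDerivAt (fun s : ℝ => (7/4:ℝ) * s) (7/4:ℝ) τ := by simpa using (hasDerivAt_id τ).const_mul (7/4:ℝ)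
    have hb : HasDerivAt (deriv (x j)) (deriv (deriv (x j)) τ) τ := (hx'd τ).hasDerivAt
    exact (ha.smul hb).congr_deriv (add_comm _ _)
  have heq : (fun s => M (x j s)) = fun s => ((7/4:ℝ) * s) • deriv (x j) s := funext hcurve
  rw [heq] at h1
  have h12 := h1.unique h2
  rw [h12, iteratedDeriv_succ, iteratedDeriv_one]

end Summit.NavierStokesRegularity.NavierStokesRegularity.Theorems.SkeletonJ1RFrame

end
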